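import Literature.NumberTheory.EllipticCurves.Kato2004.IwasawaH1LayerNormProofs
import Literature.NumberTheory.EllipticCurves.Kato2004.IwasawaH1ReductionPk
import HarnessLib

/-!
# Restriction up the `ℤ_p`-tower is INJECTIVE on `H¹(ℚ_n, T_pW)`: `T_pW` has no vector fixed by an
# open layer subgroup `Γ_m = Gal(ℚ̄/ℚ_m)`, and the inflation–restriction criterion

Topic `NumberTheory/EllipticCurves`, sub-directory `Kato2004` (helper namespace `IwasawaH1LayerNorm`,
continued from `IwasawaH1LayerNormProofs.lean`).  THEOREMS ONLY (no definition, no named fact, no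
`sorry`).  Cell `bsd-potss` (seat `bsd-potss-rkm` g7, item stmt-BirchSwinnertonDyer-19196): corollaries
of the inflation–restriction annihilator bound `IwasawaH1LayerNorm.smul_eq_zero_of_resLe_eq_zero` and of
the uniform exponent `IwasawaH1LayerNorm.exists_pow_smul_eq_zero_of_forall_smul_eq` (finiteness of
`E(ℚ_∞)[p^∞]`, tree) — recorded for the consumers of the pin `Kato2004.IwasawaH1Data` (control /
descent arguments compare `H¹(ℚ_n, T_pW)` with `H¹(ℚ_m, T_pW)^{Gal(ℚ_m/ℚ_n)}`):

* `eq_zero_of_resLe_eq_zero_of_forall_fixed_eq_zero` — general `TopRep X` of a topological group `G`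
  with continuous orbit maps, `N ⊴ G`, `N ≤ U`: if `X^N = 0` then `res : H¹(U, X) → H¹(N, X)` has
  trivial kernel (inflation–restriction: the kernel is `H¹(U/N, X^N) = 0`).
* `proj_tateModule_eq_zero_of_forall_smul_eq`, **`tateModule_eq_zero_of_forall_smul_eq`** — for every
  elliptic `E/ℚ`, prime `p`, `ℤ_p`-extension `κ` and layer `m`: a vector of `T_pW` fixed by `Γ_m` is `0`
  (`T_pW^{Γ_m} = lim← E(ℚ_m)[p^k] = 0`: the components are fixed torsion points, killed by the uniform
  `p^c`, and `a_k = p^c · a_{k+c}`).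
* **`eq_zero_of_resLe_layer_eq_zero`**, **`resLe_layer_injective`** — for `n ≤ m` the restriction
  `H¹(ℚ_n, T_pW) → H¹(ℚ_m, T_pW)` (`resLe` along `Γ_m ≤ Γ_n`) is injective.

## References

* [SerreGaloisCohomology1997] J.-P. Serre, *Galois Cohomology* (1997), I §2.6 (b) (inflation–restriction).
* [NeukirchSchmidtWingberg2008] J. Neukirch, A. Schmidt, K. Wingberg, *Cohomology of Number Fields*
  (2008), (1.6.7).
* [GreenbergLNM1716] R. Greenberg, LNM 1716 (1999), §1 p. 62, §3 p. 86 (finiteness of `E(ℚ_∞)[p^∞]`);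
  §3 (control arguments along the cyclotomic tower).
* [Kato2004Asterisque] K. Kato, Astérisque 295 (2004), §12.2 (p. 220), §13.8 (p. 228).
* Tree: `Kato2004/IwasawaH1LayerNormProofs.lean`, `Kato2004/IwasawaH1ReductionPk.lean` (`tateModPk`),
  `EllipticCurves/TateModule.lean` (`TateModule.ext`, `TateModule.smul_proj_succ`),
  `EllipticCurves/IwasawaTowerTorsionFiniteProofs.lean`.
-/

noncomputable section

open scoped NumberField
open Field CategoryTheory
open Literature.NumberTheory.GaloisRepresentations
open Literature.NumberTheory.EllipticCurves Literature.NumberTheory.EllipticCurves.Kato2004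
open Literature.NumberTheory.EllipticCurves.Kato2004.EulerSystemValues
open WeierstrassCurve (geomPoints geomTorsion geomPrimaryTorsion)

universe u v

namespace Literature.NumberTheory.EllipticCurves.Kato2004

namespace IwasawaH1LayerNorm

/-! ## The inflation–restriction criterion: `X^N = 0 ⇒ res` injective -/

section InfRes

variable {R : Type u} [Ring R] [TopologicalSpace R]
variable {G : Type v} [Group G] [TopologicalSpace G] [IsTopologicalGroup G]
variable (X : TopRep.{v} R G)

/-- **Inflation–restriction, injectivity criterion.** For `N ⊴ G`, `N ≤ U` and a topological
representation `X` of `G` with continuous orbit maps and NO non-zero `N`-fixed vector, a class in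
`H¹(U, X)` restricting to `0` on `N` is `0` (the kernel of `res` is `H¹(U/N, X^N) = 0`;
`smul_eq_zero_of_resLe_eq_zero` with the scalar `1`).
[cite: SerreGaloisCohomology1997, I §2.6 (b)] [cite: NeukirchSchmidtWingberg2008, (1.6.7)] -/
theorem eq_zero_of_resLe_eq_zero_of_forall_fixed_eq_zero (hX : ∀ v : X, Continuous fun g : G => X.ρ g v)
    {N U : Subgroup G} [N.Normal] (h : N ≤ U) (h0 : ∀ v : X, (∀ n ∈ N, X.ρ n v = v) → v = 0)
    (ξ : continuousCohomology 1 (subgroupRep X U)) (hξ : resLe X h 1 ξ = 0) : ξ = 0 := by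
  have h1 := smul_eq_zero_of_resLe_eq_zero X hX h (1 : R)
    (fun v hv => by rw [h0 v hv, smul_zero]) ξ hξ
  rwa [one_smul] at h1

end InfRes

/-! ## `T_pW` has no vector fixed by a layer subgroup `Γ_m` -/

section Tate

variable {p : ℕ} [hp : Fact p.Prime] (W : WeierstrassCurve ℚ) [W.IsElliptic] (κ : ZpExtension ℚ p)

omit hp [W.IsElliptic] in
/-- Iterated tower relation in `T_pW`: `p^c • a_{k+c} = a_k`. [cite: SilvermanAEC2009, III §7] -/
theorem pow_smul_proj_add (c k : ℕ) (a : W.tateModule p) :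
    p ^ c • TateModule.proj p (k + c) a = TateModule.proj p k a := by
  induction c with
  | zero => rw [pow_zero, one_smul, Nat.add_zero]
  | succ c ih =>
    rw [pow_succ, mul_smul, ← Nat.add_assoc, TateModule.smul_proj_succ (k + c) a, ih]

/-- **Every component of a `Γ_m`-fixed vector of `T_pW` vanishes**: `a_k = p^c • a_{k+c}` with
`a_{k+c} ∈ W[p^{k+c}]^{Γ_m}`, which the uniform exponent `p^c` kills
(`exists_pow_smul_eq_zero_of_forall_smul_eq`). [cite: GreenbergLNM1716, §1 p. 62 and §3 p. 86] -/
theorem proj_tateModule_eq_zero_of_forall_smul_eq (m : ℕ) (a : W.tateModule p)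
    (ha : ∀ g ∈ κ.layerSubgroup m, g • a = a) (k : ℕ) : TateModule.proj p k a = 0 := by
  obtain ⟨c, hc⟩ := exists_pow_smul_eq_zero_of_forall_smul_eq (p := p) W κ
  have hfix : ∀ g ∈ κ.layerSubgroup m, g • tateModPk W p (k + c) a = tateModPk W p (k + c) a :=
    fun g hg => by rw [← tateModPk_smul, ha g hg]
  have h0 := congrArg (fun v : geomTorsion W ((p : ℤ) ^ (k + c)) => (v : geomPoints W))
    (hc (k + c) m _ hfix)
  simp only [AddSubmonoidClass.coe_nsmul, coe_tateModPk_apply, ZeroMemClass.coe_zero] at h0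
  rw [← pow_smul_proj_add W c k a, h0]

/-- **`T_pW^{Γ_m} = 0`**: for every elliptic curve `E/ℚ`, prime `p`, `ℤ_p`-extension `κ` of `ℚ` and
layer `m`, a vector of the Tate module fixed by `Γ_m = Gal(ℚ̄/ℚ_m)` is zero (`E(ℚ_m)[p^∞]` — indeed
`E(ℚ_∞)[p^∞]` — is finite, so `lim← E(ℚ_m)[p^k] = 0`). [cite: GreenbergLNM1716, §1 p. 62 and §3 p. 86] -/
theorem tateModule_eq_zero_of_forall_smul_eq (m : ℕ) (a : W.tateModule p)
    (ha : ∀ g ∈ κ.layerSubgroup m, g • a = a) : a = 0 :=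
  TateModule.ext fun k => by
    rw [proj_tateModule_eq_zero_of_forall_smul_eq W κ m a ha k, map_zero]

variable [ContinuousSMul ℤ_[p] (W.tateModule p)]

/-- **Restriction up the tower is injective on `H¹(ℚ_n, T_pW)`**: for `n ≤ m`, a class in
`H¹(ℚ_n, T_pW)` whose restriction to `Γ_m = Gal(ℚ̄/ℚ_m)` vanishes is zero (inflation–restriction with
`T_pW^{Γ_m} = 0`). [cite: GreenbergLNM1716, §3] [cite: SerreGaloisCohomology1997, I §2.6 (b)] -/
theorem eq_zero_of_resLe_layer_eq_zero {n m : ℕ} (hnm : n ≤ m)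
    (ξ : H1 (tateRep W p) (κ.layerSubgroup n))
    (hξ : resLe (tateRep W p).toTopRep (κ.layerSubgroup_antitone hnm) 1 ξ = 0) : ξ = 0 :=
  eq_zero_of_resLe_eq_zero_of_forall_fixed_eq_zero (tateRep W p).toTopRep
    (fun v => (tateRep W p).continuous_apply_left v) (κ.layerSubgroup_antitone hnm)
    (fun v hv => tateModule_eq_zero_of_forall_smul_eq W κ m v hv) ξ hξ

/-- **`res : H¹(ℚ_n, T_pW) → H¹(ℚ_m, T_pW)` is injective** (`n ≤ m`), as a statement about the map.
[cite: GreenbergLNM1716, §3] [cite: SerreGaloisCohomology1997, I §2.6 (b)] -/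
theorem resLe_layer_injective {n m : ℕ} (hnm : n ≤ m) :
    Function.Injective
      (fun ξ : H1 (tateRep W p) (κ.layerSubgroup n) =>
        resLe (tateRep W p).toTopRep (κ.layerSubgroup_antitone hnm) 1 ξ) := by
  intro ξ ξ' h
  rw [← sub_eq_zero]
  refine eq_zero_of_resLe_layer_eq_zero W κ hnm (ξ - ξ') ?_
  rw [map_sub, sub_eq_zero]
  exact h

end Tate

end IwasawaH1LayerNorm

end Literature.NumberTheory.EllipticCurves.Kato2004

end
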